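import Mathlib
import Summits.Ventures.HodgeRepro2.LevelPositivity
import Summits.Ventures.HodgeRepro2.LiuOscillator
import Summits.Ventures.HodgeRepro2.T6B3Hyp
import Summits.Ventures.HodgeRepro2.T6B5Datum
import Summits.Ventures.HodgeRepro2.T6B5Hyp
import Summits.Ventures.HodgeRepro2.T6B5Main
import Summits.Ventures.HodgeRepro2.T6B5OrbitHyp
import Summits.Ventures.HodgeRepro2.T6B5Orbit
import Summits.Ventures.HodgeRepro2.T6B5IsoHyp
import Summits.Ventures.HodgeRepro2.T6B5Identity

/-!
# T6B5Full — Tier 6, sub-goal B5: TIER4 Theorem B5.1 (i)–(v) and Corollary B5.2 in ONE kernel statement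

`B5_full` assembles the accepted `B5_main` (clauses (i), (ii), the Hom ≠ 0 half of (iv)), the shape's `dimInv_anti`
(iii), `B5_identity` (the identity of (iv)) and `B5_orbit` ((v) + Corollary B5.2's exponents at the representatives)
at ONE level `K` (= `K₀ ∩ Stab(v₁) ∩ ⋯ ∩ Stab(v₄)`, Lemma B5.5(3)) for every compact open `K' ⊆ K`: TIER4 §B5
Theorem B5.1 as scored, with every published input consumed BY NAME — the displayed Def. 4.11 and the isomorphism of
Thm. 4.18 (B5; the number-field display is not needed here: Hom ≠ 0 comes from `B5_main` through t6-p6's numeric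
display), the index-set clause of Prop. C.5 below the threshold (B2's display, reading (SS)), t6-p6's displays of
Thm. 4.18 (two clauses) and Cor. 4.20 and the displayed last sentence of Cor. 4.20 at the shape, the four admissible
triples of B3. `B5_full_neat` adds the neat clause of (i) from the author-copy
display of Ullmo–Yafaev / Daw. README §8(d): uses an L-value-free non-vanishing device: NO.
-/

namespace Summit.Ventures.HodgeRepro2.T6.B5Full

open Summit.Ventures.HodgeRepro2.LevelPositivity Summit.Ventures.HodgeRepro2.ShimuraData
  Summit.Ventures.HodgeRepro2.T6.B5Datum Summit.Ventures.HodgeRepro2.T6.B5Main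
  Summit.Ventures.HodgeRepro2.T6.B5Orbit Summit.Ventures.HodgeRepro2.T6.B5Identity
  Summit.Ventures.HodgeRepro2.T6.Hyp
open Module

universe u

variable {K : Type u} [Field K] [NumberField K] [NumberField.IsCMField K] {c : Liu.IdeleConjugation K}
  {χEF : Liu.QuadraticCharacter K c} (𝓛 : LiuAlbaneseDatum K c χEF)

/-- The clauses (i)–(v) of TIER4 Theorem B5.1 and Corollary B5.2 at one level `L'` of the shape, for the four
triples `t` (a `Prop`-valued abbreviation, so that `B5_full` and `B5_full_neat` state the same conclusion). -/
def B5Clauses (h411 : Liu2021_Def4_11 𝓛) (K₀ : OpenSubgroup 𝓛.G)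
    (t : Fin 4 → Liu.OscillatorTriple K c χEF) (L' : CLevel 𝓛) : Prop :=
  -- (i) the level is in the index set of the tower
  𝓛.IsIndex L'.1 ∧
  -- (ii) single-level positivity: dim ω(μ_i, ε_i, χ_i)^{L'} ≥ 1 for i = 1..4
  (∀ i, 0 < (shape 𝓛 h411 K₀).dimInv ((shape 𝓛 h411 K₀).osc (t i)) L') ∧
  -- (iii) monotonicity below L'
  (∀ i, ∀ L'' : CLevel 𝓛, L'' ≤ L' →
    (shape 𝓛 h411 K₀).dimInv ((shape 𝓛 h411 K₀).osc (t i)) L' ≤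
      (shape 𝓛 h411 K₀).dimInv ((shape 𝓛 h411 K₀).osc (t i)) L'') ∧
  -- (iv) the Hom-form identity for every weight-one conjugate symplectic μ and every exhausting set, and Hom ≠ 0 for μ_i
  (∀ μ, Liu.IsWeightOneConjugateSymplectic K c χEF μ →
    ∀ T : Finset (Liu.OscillatorTriple K c χEF), IsExhausting (shape 𝓛 h411 K₀) μ T L' →
      finrank ℚ (𝓛.Mt μ) * Liu.liuMultiplicity K (shape 𝓛 h411 K₀) T L' = finrank ℚ (𝓛.HomQ L'.1 μ)) ∧
  (∀ i, Nontrivial (𝓛.HomQ L'.1 (t i).μ)) ∧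
  -- (v) + Corollary B5.2: Cor. 4.20's decomposition at L' with orbit-invariant exponents; the factor of the orbit
  -- of each μ_i, at its representative, has exponent d(μ'_i, L') = d(μ_i, L') ≥ 1
  ∃ (reps : Finset (Liu.AutomorphicCharacter K))
    (T : Liu.AutomorphicCharacter K → Finset (Liu.OscillatorTriple K c χEF)),
    (∀ μ ∈ reps, Liu.IsWeightOneConjugateSymplectic K c χEF μ) ∧
    (∀ μ, IsExhausting (shape 𝓛 h411 K₀) μ (T μ) L') ∧
    (∀ μ ∈ reps, ∀ μ' ∈ reps, (shape 𝓛 h411 K₀).galOrbit μ μ' → μ = μ') ∧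
    (shape 𝓛 h411 K₀).albanese L' =
      ∏ μ ∈ reps, (shape 𝓛 h411 K₀).cmVariety μ ^ Liu.liuMultiplicity K (shape 𝓛 h411 K₀) (T μ) L' ∧
    (∀ i, 0 < Liu.liuMultiplicity K (shape 𝓛 h411 K₀) (T (t i).μ) L') ∧
    (∀ i (μ'' : Liu.AutomorphicCharacter K), Liu.IsWeightOneConjugateSymplectic K c χEF μ'' →
      (shape 𝓛 h411 K₀).galOrbit (t i).μ μ'' →
      Liu.liuMultiplicity K (shape 𝓛 h411 K₀) (T μ'') L' =
        Liu.liuMultiplicity K (shape 𝓛 h411 K₀) (T (t i).μ) L') ∧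
    (∀ i, ∃ μ' ∈ reps, (shape 𝓛 h411 K₀).galOrbit (t i).μ μ' ∧
      0 < Liu.liuMultiplicity K (shape 𝓛 h411 K₀) (T μ') L' ∧
      Liu.liuMultiplicity K (shape 𝓛 h411 K₀) (T μ') L' =
        Liu.liuMultiplicity K (shape 𝓛 h411 K₀) (T (t i).μ) L')

/-- TIER4 THEOREM B5.1 (i)–(v) + COROLLARY B5.2 at one level: there is a compact open `L ≤ K₀` such that every
compact open `L' ≤ L` satisfies `B5Clauses`. Inputs, all by name: the displayed Def. 4.11, the displayed isomorphism
of Thm. 4.18 (B5), the index-set clause of Prop. C.5 below `K₀` (B2's display), t6-p6's displays of Thm. 4.18 (the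
numeric clause and (1)) and of Cor. 4.20 at the shape, the displayed last sentence of Cor. 4.20 at the shape,
`n ⩾ 3`, the four admissible triples of B3. -/
theorem B5_full (h411 : Liu2021_Def4_11 𝓛) (K₀ : OpenSubgroup 𝓛.G) (hK₀ : IsCompact (K₀ : Set 𝓛.G))
    (hIdx : ∀ L : OpenSubgroup 𝓛.G, IsCompact (L : Set 𝓛.G) → L ≤ K₀ → 𝓛.IsIndex L)
    (hds : Liu2021_Thm4_18_directSum 𝓛)
    (h418i : Liu2021_Thm4_18_iso (shape 𝓛 h411 K₀)) (h4181 : Liu2021_Thm4_18_1 (shape 𝓛 h411 K₀))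
    (h420 : Liu2021_Cor4_20 (shape 𝓛 h411 K₀)) (horb : Liu2021_Cor4_20_orbit (shape 𝓛 h411 K₀))
    (hn : 3 ≤ 𝓛.n)
    (t : Fin 4 → Liu.OscillatorTriple K c χEF) (ht : ∀ i, Liu.OscillatorTriple.IsAdmissible K (t i)) :
    ∃ L : CLevel 𝓛, (shape 𝓛 h411 K₀).IsSmall L ∧
      ∀ L' : CLevel 𝓛, L' ≤ L → B5Clauses 𝓛 h411 K₀ t L' := by
  obtain ⟨L, hL, hmain⟩ := B5_main 𝓛 h411 K₀ hK₀ hIdx h418i h4181 t ht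
  refine ⟨L, hL, fun L' hle => ?_⟩
  obtain ⟨hidx, hpos, -, hne⟩ := hmain L' hle
  have hsmall : (shape 𝓛 h411 K₀).IsSmall L' := (shape 𝓛 h411 K₀).isSmall_of_le hle hL
  refine ⟨hidx, hpos, fun i L'' hle'' => (shape 𝓛 h411 K₀).dimInv_anti _ hle'',
    fun μ hμ T hT => B5_identity 𝓛 h411 K₀ hds h4181 μ hμ L' hsmall T hT, hne, ?_⟩
  exact B5_orbit 𝓛 h411 K₀ h420 horb hn t ht L' hsmall hpos

/-- `B5_full` with the neat clause of Theorem B5.1(i): below a neat compact open subgroup of `K₀` (the author-copy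
display of Ullmo–Yafaev / Daw), so that every `L' ≤ L` is neat (`Elementwise 𝓛.neat`). -/
theorem B5_full_neat (h411 : Liu2021_Def4_11 𝓛) (K₀ : OpenSubgroup 𝓛.G) (hK₀ : IsCompact (K₀ : Set 𝓛.G))
    (hIdx : ∀ L : OpenSubgroup 𝓛.G, IsCompact (L : Set 𝓛.G) → L ≤ K₀ → 𝓛.IsIndex L)
    (hds : Liu2021_Thm4_18_directSum 𝓛)
    (h418i : Liu2021_Thm4_18_iso (shape 𝓛 h411 K₀)) (h4181 : Liu2021_Thm4_18_1 (shape 𝓛 h411 K₀))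
    (h420 : Liu2021_Cor4_20 (shape 𝓛 h411 K₀)) (horb : Liu2021_Cor4_20_orbit (shape 𝓛 h411 K₀))
    (hUY : UllmoYafaev2014_neatInside 𝓛) (hn : 3 ≤ 𝓛.n)
    (t : Fin 4 → Liu.OscillatorTriple K c χEF) (ht : ∀ i, Liu.OscillatorTriple.IsAdmissible K (t i)) :
    ∃ L : CLevel 𝓛, (shape 𝓛 h411 K₀).IsSmall L ∧
      ∀ L' : CLevel 𝓛, L' ≤ L → Elementwise 𝓛.neat (L'.1 : Subgroup 𝓛.G) ∧ B5Clauses 𝓛 h411 K₀ t L' := by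
  obtain ⟨L, hL, hmain⟩ := B5_main_neat 𝓛 h411 K₀ hK₀ hIdx h418i h4181 hUY t ht
  refine ⟨L, hL, fun L' hle => ?_⟩
  obtain ⟨hneat, hidx, hpos, -, hne⟩ := hmain L' hle
  have hsmall : (shape 𝓛 h411 K₀).IsSmall L' := (shape 𝓛 h411 K₀).isSmall_of_le hle hL
  refine ⟨hneat, hidx, hpos, fun i L'' hle'' => (shape 𝓛 h411 K₀).dimInv_anti _ hle'',
    fun μ hμ T hT => B5_identity 𝓛 h411 K₀ hds h4181 μ hμ L' hsmall T hT, hne, ?_⟩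
  exact B5_orbit 𝓛 h411 K₀ h420 horb hn t ht L' hsmall hpos

end Summit.Ventures.HodgeRepro2.T6.B5Full
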